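import Mathlib
import HarnessLib
import Summits.HodgeConjecture.HodgeConjecture.Theorems.HodgeLocusCensusSurfaceFermatColumns

/-!
# HodgeLocusCensusSurfaceAllDegrees — the Fermat column of the SURFACE cells (2,d,0) for EVERY degree d ≥ 6: the uniform certificate of gen 23 DERIVED from the period rule (cell pub-hlocus, LEAD seat ivhs-1, gen 31)
HONEST FRAMING: certified instances and evidence bearing on the general Hodge conjecture; no claim.

SETTING (record `data/ivhs/census/og81/MU0-SURFACES-ALLD-g31.md`, files `pub-hlocus-ivhs-1/gen31/SURF/`; continuation of `HodgeLocusCensusSurfaceFermatColumns`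
(gen 23: the uniform forms CERTIFIED for 6 ≤ d ≤ 12; gen 25: 13 ≤ d ≤ 20) — which left 'all d' as NOT PROVED).  X_F = Fermat surface of degree d in ℙ³, z = ζ_{2d},
L = {x₀ = z x₁, x₂ = z x₃}, L' = {x₀ = z x₁, x₂ = z³ x₃}, γ_λ = [L] + λ[L'], V_λ its Hodge-locus germ at X_F, Λ = {x^(0,a,j,d−a−j) : 2 ≤ a ≤ d − 2, j = 0, 1} the
census complement of T N, N = NL(L ∪ L').  PERIOD RULE at the Fermat point (engine A = [Movasati, arXiv:1602.06607, Thm 15; MovBook §13.9–13.10, 17.11], phases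
[MV18 = arXiv:1705.00084, Thm 1]): for a reduced index i (|i| = 2d − 4) the periods are p_L(i) = z^((i₀+1)+(i₂+1)), p_L'(i) = z^((i₀+1)+3(i₂+1)) if
i₀ + i₁ = d − 2 = i₂ + i₃ and 0 otherwise; the tangent matrix is M[β, α] = p_γ(β + α) (β ∈ I_{d−4}) and the second Taylor coefficients carry the Pochhammer factor r₃/d.
DERIVATION (record §2; d is a free symbol throughout): (1) M(λ) is block diagonal, column block a = α₁ meeting only the rows with β₀ + β₁ = d − 2 − a; block 2
(the two chart columns #0, #1) has rank 1 with kernel vector v = (E₁, −E₀), E₀ = z²(1 + λz²)·z^0, E₁ = z³(1 + λz⁴) (up to the common row factor), and every block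
a ≥ 3 has rank 2 iff λ ≠ 0 (`block_minor`: its 2 × 2 minors are λ·X⁴z²(z² − 1)², X = z^(β₂+1)) — so rank M(λ) = 2d − 7 for λ ≠ 0 and 0 ∈ E_F;
(2) the second-order vector w = Q(v,v) is supported on the rows of block 4 (β₀ + β₁ = d − 6; absent for d = 5, the known exception), whose rows come in the
three types (β₂,β₃) = p = (0,2), q = (1,1), t = (2,0) up to the unit row factor z^β₀; (3) hence the engine's chart certificate of the row t = (0, d−6, 2, 0) is
CF_f = det[c₀ c₁ w](p,q,t) / (m_pq · v_f²) with the EXPLICIT entries below, and (4) the 3 × 3 determinant is −z²²(z² − 1)⁵λ²(1 − λ)/(2d) (`bordered_det`,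
d-free apart from the factor 1/d): for λ ≠ 0 the second-order obstruction vanishes iff λ = 1 (`secondOrder_vanishes_iff`), i.e. E_F(d) = {0, 1} for every
d ≥ 6, and CF_f equals the uniform function `certF0` / `certF1` of gen 23 with c = 2d and pole z^(d−4) = −z⁻⁴ / z^(d−2) = −z⁻² (`fermatColumn_free0/1`,
using only z^d = −1).  Combined with gen 23's `cover`, for every d ≥ 6 and every λ ∉ {0, 1} one chart is valid at λ with a non-zero certificate.
TWO IMPLEMENTATIONS of the derivation (gen31/SURF): `surf_symbolic.py` (own exact polynomial arithmetic, d and z free symbols: identities (I)–(IV)) and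
`surf_dense_modp.py` (the GENERAL rule, dense, all C(d−1,3) rows and 2(d−3) columns, no block assumption, in 𝔽_p with z of exact order 2d, d = 5, …, 34: block
structure, ranks d − 3 / 2d − 7, support of v and w, E_F = {0,1} among all tested λ including every power of z, and both chart certificates = the uniform forms).
READING (unchanged, gen 22 / referee R88, NOT formalised): certificate ≠ 0 in a valid chart ⇒ the Fermat slice of V_λ is a fat point of length 2 ⇒ μ₀(2,d,0;λ) ≤ 2,
= 2 by Dan's strict excess (`Literature.AlgebraicGeometry.Kloosterman2025.coplanarLines_idealDegree_inf_lt`).  So, granted the period rule and the reading: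
μ₀(2,d,0; λ) = 2 for EVERY d ≥ 6 and every λ ∉ {0, 1} (previously: verified d ≤ 20).
WHAT THE KERNEL CHECKS: the polynomial identities of steps (1), (3), (4) over any commutative ring, the exceptional-set statement (4) over any field, and the
identification with `certF0` / `certF1` over any field of characteristic 0 for any z with z^n = −1 (n ≥ 6), z² ≠ 1.  NOT FORMALISED: the period rule itself, the
block/support bookkeeping of steps (1)–(2) (finite index combinatorics, checked by the two implementations), the passage to μ₀, all Hodge theory.
Nothing here is a statement about the Hodge conjecture.
-/

namespace Summit.HodgeConjecture.HodgeConjecture.HodgeLocus.Census.SurfaceAllDegrees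

open Summit.HodgeConjecture.HodgeConjecture.HodgeLocus.Census.SurfaceFermatColumns (certF0 certF1)

section ring

variable {R : Type*} [CommRing R]

/-- Step (1), blocks a ≥ 3: the 2 × 2 minor of a column block on the rows (β₀, ·, β₂, ·), (β₀, ·, β₂ + 1, ·) and the columns j = 0, 1, after removing the common
row factor z^(β₀+1) and writing X = z^(β₂+1): entries z^(s+j)·X + λ z^(3(s+j))·X³ (s = row shift, j = column).  It is λ·X⁴·z²·(z² − 1)²: non-zero iff λ ≠ 0
(z a root of unity with z² ≠ 1), so every block a ≥ 3 has rank exactly 2 for λ ≠ 0 and rank 1 at λ = 0. -/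
theorem block_minor (lam z X : R) :
    (X + lam * X ^ 3) * (z ^ 2 * X + lam * (z ^ 6 * X ^ 3)) - (z * X + lam * (z ^ 3 * X ^ 3)) * (z * X + lam * (z ^ 3 * X ^ 3))
      = lam * X ^ 4 * z ^ 2 * (z ^ 2 - 1) ^ 2 := by
  ring

/-- Step (1), block 2: the pivot-row entries of the two chart columns are E₀ = z² + λz⁴ (#0 = x^(0,2,0,d−2)) and E₁ = z³ + λz⁷ (#1 = x^(0,2,1,d−3));
v = (E₁, −E₀) spans the kernel (the block has rank 1: all its rows are multiples of the pivot row). -/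
theorem block2_kernel (lam z : R) :
    (z ^ 2 + lam * z ^ 4) * (z ^ 3 + lam * z ^ 7) + (z ^ 3 + lam * z ^ 7) * (-(z ^ 2 + lam * z ^ 4)) = 0 := by
  ring

/-- Step (3), block 4: the first-order entries of the row types p = (0,2), q = (1,1), t = (2,0) are c_j = z^(β₂+j+2) + λ z^(3β₂+3j+4); the pivot minor on p, q is
m_pq = λ z⁸ (z² − 1)². -/
theorem block4_minor (lam z : R) :
    (z ^ 2 + lam * z ^ 4) * (z ^ 4 + lam * z ^ 10) - (z ^ 3 + lam * z ^ 7) * (z ^ 3 + lam * z ^ 7) = lam * z ^ 8 * (z ^ 2 - 1) ^ 2 := by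
  ring

/-- Step (4): the bordered 3 × 3 determinant.  Third column = 2d·w, where w(β₂,β₃) = Σ_{j ≤ j'} (1/a!)·((β₃ + d − 3 − j − j')/d)·(z^(β₂+j+j'+2) + λ z^(3(β₂+j+j')+4))·v_j v_j'
is the second-order coefficient along v = (v₀, v₁) = (E₁, −E₀) (only x₃ overflows, once: Pochhammer factor r₃/d).  The determinant is −z²²(z² − 1)⁵·λ²(1 − λ):
it does not depend on d, and for λ ≠ 0, z ≠ 0, z² ≠ 1 it vanishes iff λ = 1. -/
theorem bordered_det (lam z d E0 E1 : R) (hE0 : E0 = z ^ 2 + lam * z ^ 4) (hE1 : E1 = z ^ 3 + lam * z ^ 7) :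
    Matrix.det !![z ^ 2 + lam * z ^ 4, z ^ 3 + lam * z ^ 7,
        (d - 1) * (z ^ 2 + lam * z ^ 4) * E1 ^ 2 - 2 * (d - 2) * (z ^ 3 + lam * z ^ 7) * E1 * E0 + (d - 3) * (z ^ 4 + lam * z ^ 10) * E0 ^ 2;
      z ^ 3 + lam * z ^ 7, z ^ 4 + lam * z ^ 10,
        (d - 2) * (z ^ 3 + lam * z ^ 7) * E1 ^ 2 - 2 * (d - 3) * (z ^ 4 + lam * z ^ 10) * E1 * E0 + (d - 4) * (z ^ 5 + lam * z ^ 13) * E0 ^ 2;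
      z ^ 4 + lam * z ^ 10, z ^ 5 + lam * z ^ 13,
        (d - 3) * (z ^ 4 + lam * z ^ 10) * E1 ^ 2 - 2 * (d - 4) * (z ^ 5 + lam * z ^ 13) * E1 * E0 + (d - 5) * (z ^ 6 + lam * z ^ 16) * E0 ^ 2]
      = -(z ^ 22 * (z ^ 2 - 1) ^ 5 * lam ^ 2 * (1 - lam)) := by
  subst hE0 hE1
  rw [Matrix.det_fin_three]
  simp only [Matrix.of_apply, Matrix.cons_val', Matrix.cons_val_zero, Matrix.cons_val_one, Matrix.cons_val_two, Matrix.empty_val',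
    Matrix.cons_val_fin_one, Matrix.head_cons, Matrix.head_fin_const, Matrix.tail_cons]
  ring

/-- Identity (I) of the record: twice the bordered determinant equals (1 − z²)³·λ(1 − λ)·z¹⁴·m_pq — the polynomial form of BOTH chart identities
CF₀ = (1 − z²)³/(2d)·λ(1 − λ)/(λ − z^(d−4))² and CF₁ = z⁶(1 − z²)³/(2d)·λ(1 − λ)/(λ − z^(d−2))² (v₀² = z¹⁴(λ + z⁻⁴)², v₁² = z⁸(λ + z⁻²)², z^d = −1). -/
theorem identity_I (lam z : R) :
    2 * (-(z ^ 22 * (z ^ 2 - 1) ^ 5 * lam ^ 2 * (1 - lam)))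
      = 2 * ((1 - z ^ 2) ^ 3 * (lam * (1 - lam)) * z ^ 14 * (lam * z ^ 8 * (z ^ 2 - 1) ^ 2)) := by
  ring

end ring

section field

variable {K : Type*} [Field K]

/-- E_F ∖ {0} = {1}: for λ ≠ 0 (and z ≠ 0, z² ≠ 1) the bordered determinant vanishes iff λ = 1. -/
theorem secondOrder_vanishes_iff {z lam : K} (hz : z ≠ 0) (hz2 : z ^ 2 ≠ 1) (h0 : lam ≠ 0) :
    -(z ^ 22 * (z ^ 2 - 1) ^ 5 * lam ^ 2 * (1 - lam)) = 0 ↔ lam = 1 := by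
  have hz2' : z ^ 2 - 1 ≠ 0 := sub_ne_zero.mpr hz2
  have h1 : z ^ 22 * (z ^ 2 - 1) ^ 5 * lam ^ 2 ≠ 0 :=
    mul_ne_zero (mul_ne_zero (pow_ne_zero _ hz) (pow_ne_zero _ hz2')) (pow_ne_zero _ h0)
  refine ⟨fun h => ?_, fun h => by subst h; ring⟩
  rw [neg_eq_zero] at h
  have h2 : 1 - lam = 0 := (mul_eq_zero.mp h).resolve_left h1
  linear_combination -h2

/-- Step (4) with the TRUE second-order column w = (2d·w)/c, c = 2d (over a field; any c): det[c₀ c₁ w](p,q,t) = −z²²(z² − 1)⁵λ²(1 − λ)/c. -/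
theorem bordered_det_w (lam z d c E0 E1 : K) (hE0 : E0 = z ^ 2 + lam * z ^ 4) (hE1 : E1 = z ^ 3 + lam * z ^ 7) :
    Matrix.det !![z ^ 2 + lam * z ^ 4, z ^ 3 + lam * z ^ 7,
        ((d - 1) * (z ^ 2 + lam * z ^ 4) * E1 ^ 2 - 2 * (d - 2) * (z ^ 3 + lam * z ^ 7) * E1 * E0 + (d - 3) * (z ^ 4 + lam * z ^ 10) * E0 ^ 2) / c;
      z ^ 3 + lam * z ^ 7, z ^ 4 + lam * z ^ 10,
        ((d - 2) * (z ^ 3 + lam * z ^ 7) * E1 ^ 2 - 2 * (d - 3) * (z ^ 4 + lam * z ^ 10) * E1 * E0 + (d - 4) * (z ^ 5 + lam * z ^ 13) * E0 ^ 2) / c;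
      z ^ 4 + lam * z ^ 10, z ^ 5 + lam * z ^ 13,
        ((d - 3) * (z ^ 4 + lam * z ^ 10) * E1 ^ 2 - 2 * (d - 4) * (z ^ 5 + lam * z ^ 13) * E1 * E0 + (d - 5) * (z ^ 6 + lam * z ^ 16) * E0 ^ 2) / c]
      = -(z ^ 22 * (z ^ 2 - 1) ^ 5 * lam ^ 2 * (1 - lam)) / c := by
  subst hE0 hE1
  rw [Matrix.det_fin_three]
  simp only [Matrix.of_apply, Matrix.cons_val', Matrix.cons_val_zero, Matrix.cons_val_one, Matrix.cons_val_two, Matrix.empty_val',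
    Matrix.cons_val_fin_one, Matrix.head_cons, Matrix.head_fin_const, Matrix.tail_cons]
  ring

/-- the chart-free-0 pole: z^(n−4) = −z⁻⁴ when z^n = −1. -/
theorem pole_free0 {z : K} (hz : z ≠ 0) {n : ℕ} (hn : z ^ n = -1) (h4 : 4 ≤ n) : z ^ (n - 4) = -(z ^ 4)⁻¹ := by
  have h : z ^ (n - 4) * z ^ 4 = -1 := by rw [← pow_add, Nat.sub_add_cancel h4, hn]
  have hz4 : z ^ 4 ≠ 0 := pow_ne_zero _ hz
  have e : z ^ (n - 4) = z ^ (n - 4) * z ^ 4 * (z ^ 4)⁻¹ := by rw [mul_assoc, mul_inv_cancel₀ hz4, mul_one]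
  rw [e, h, neg_mul, one_mul]

/-- the chart-free-1 pole: z^(n−2) = −z⁻² when z^n = −1. -/
theorem pole_free1 {z : K} (hz : z ≠ 0) {n : ℕ} (hn : z ^ n = -1) (h2 : 2 ≤ n) : z ^ (n - 2) = -(z ^ 2)⁻¹ := by
  have h : z ^ (n - 2) * z ^ 2 = -1 := by rw [← pow_add, Nat.sub_add_cancel h2, hn]
  have hz2 : z ^ 2 ≠ 0 := pow_ne_zero _ hz
  have e : z ^ (n - 2) = z ^ (n - 2) * z ^ 2 * (z ^ 2)⁻¹ := by rw [mul_assoc, mul_inv_cancel₀ hz2, mul_one]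
  rw [e, h, neg_mul, one_mul]

variable [CharZero K]

/-- chart free-0, value form: −z²²(z² − 1)⁵λ²(1 − λ)/(2n) divided by m_pq·v₀² (m_pq = λz⁸(z² − 1)², v₀ = E₁ = z³(1 + λz⁴)) is `certF0 (2n) (n − 4) z λ` of
gen 23, for any z with z^n = −1 (n ≥ 6), z² ≠ 1 and any λ ≠ 0 off the pole (1 + λz⁴ ≠ 0). -/
theorem certF0_eq_value {z lam : K} {n : ℕ} (hz : z ≠ 0) (hz2 : z ^ 2 ≠ 1) (hn : z ^ n = -1) (h6 : 6 ≤ n) (h0 : lam ≠ 0)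
    (hv : 1 + lam * z ^ 4 ≠ 0) :
    (-(z ^ 22 * (z ^ 2 - 1) ^ 5 * lam ^ 2 * (1 - lam)) / (2 * (n : K)))
        / ((lam * z ^ 8 * (z ^ 2 - 1) ^ 2) * (z ^ 3 + lam * z ^ 7) ^ 2)
      = certF0 (2 * (n : K)) (n - 4) z lam := by
  have hnK : (n : K) ≠ 0 := by exact_mod_cast (show n ≠ 0 by omega)
  have h2n : (2 * (n : K)) ≠ 0 := mul_ne_zero two_ne_zero hnK
  have hz2' : z ^ 2 - 1 ≠ 0 := sub_ne_zero.mpr hz2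
  have hz2'' : 1 - z ^ 2 ≠ 0 := fun h => hz2' (by linear_combination -h)
  have hv' : lam * z ^ 4 + 1 ≠ 0 := by rw [add_comm]; exact hv
  have hz4 : z ^ 4 ≠ 0 := pow_ne_zero _ hz
  have hpole : lam - z ^ (n - 4) = (lam * z ^ 4 + 1) / z ^ 4 := by
    rw [pole_free0 hz hn (by omega), sub_neg_eq_add, eq_div_iff hz4, add_mul, inv_mul_cancel₀ hz4]
  unfold certF0
  rw [hpole]
  have hE1 : z ^ 3 + lam * z ^ 7 = z ^ 3 * (lam * z ^ 4 + 1) := by ring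
  rw [hE1]
  field_simp
  ring

/-- chart free-1, value form: the same with v₁ = −E₀ = −z²(1 + λz²) and pole hypothesis 1 + λz² ≠ 0 gives `certF1 (2n) (n − 2) z λ`. -/
theorem certF1_eq_value {z lam : K} {n : ℕ} (hz : z ≠ 0) (hz2 : z ^ 2 ≠ 1) (hn : z ^ n = -1) (h6 : 6 ≤ n) (h0 : lam ≠ 0)
    (hv : 1 + lam * z ^ 2 ≠ 0) :
    (-(z ^ 22 * (z ^ 2 - 1) ^ 5 * lam ^ 2 * (1 - lam)) / (2 * (n : K)))
        / ((lam * z ^ 8 * (z ^ 2 - 1) ^ 2) * (-(z ^ 2 + lam * z ^ 4)) ^ 2)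
      = certF1 (2 * (n : K)) (n - 2) z lam := by
  have hnK : (n : K) ≠ 0 := by exact_mod_cast (show n ≠ 0 by omega)
  have h2n : (2 * (n : K)) ≠ 0 := mul_ne_zero two_ne_zero hnK
  have hz2' : z ^ 2 - 1 ≠ 0 := sub_ne_zero.mpr hz2
  have hv' : lam * z ^ 2 + 1 ≠ 0 := by rw [add_comm]; exact hv
  have hz2z : z ^ 2 ≠ 0 := pow_ne_zero _ hz
  have hpole : lam - z ^ (n - 2) = (lam * z ^ 2 + 1) / z ^ 2 := by
    rw [pole_free1 hz hn (by omega), sub_neg_eq_add, eq_div_iff hz2z, add_mul, inv_mul_cancel₀ hz2z]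
  unfold certF1
  rw [hpole]
  have hE0 : -(z ^ 2 + lam * z ^ 4) = -(z ^ 2 * (lam * z ^ 2 + 1)) := by ring
  rw [hE0]
  field_simp
  ring

/-- DERIVATION OF THE UNIFORM CERTIFICATE, chart free-0 (free column #0 = x^(0,2,0,d−2), v = (E₁, −E₀), v₀ = E₁): the engine's reduced second-order
coefficient of the row t = (0,d−6,2,0), i.e. det[c₀ c₁ w](p,q,t) / (m_pq · v₀²) with the EXPLICIT period-rule entries (d = n, w with its factors (β₃+d−3−j−j')/d
and 1/a!), equals the uniform function `certF0 (2n) (n − 4) z λ` of gen 23 — for EVERY n ≥ 6, any z with z^n = −1 and z² ≠ 1 (e.g. z = ζ_{2n}), any λ ≠ 0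
off the chart's pole. -/
theorem fermatColumn_free0 {z lam : K} {n : ℕ} (hz : z ≠ 0) (hz2 : z ^ 2 ≠ 1) (hn : z ^ n = -1) (h6 : 6 ≤ n) (h0 : lam ≠ 0)
    (hv : 1 + lam * z ^ 4 ≠ 0) :
    Matrix.det !![z ^ 2 + lam * z ^ 4, z ^ 3 + lam * z ^ 7,
        (((n : K) - 1) * (z ^ 2 + lam * z ^ 4) * (z ^ 3 + lam * z ^ 7) ^ 2 - 2 * ((n : K) - 2) * (z ^ 3 + lam * z ^ 7) * (z ^ 3 + lam * z ^ 7) * (z ^ 2 + lam * z ^ 4) + ((n : K) - 3) * (z ^ 4 + lam * z ^ 10) * (z ^ 2 + lam * z ^ 4) ^ 2) / (2 * (n : K));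
      z ^ 3 + lam * z ^ 7, z ^ 4 + lam * z ^ 10,
        (((n : K) - 2) * (z ^ 3 + lam * z ^ 7) * (z ^ 3 + lam * z ^ 7) ^ 2 - 2 * ((n : K) - 3) * (z ^ 4 + lam * z ^ 10) * (z ^ 3 + lam * z ^ 7) * (z ^ 2 + lam * z ^ 4) + ((n : K) - 4) * (z ^ 5 + lam * z ^ 13) * (z ^ 2 + lam * z ^ 4) ^ 2) / (2 * (n : K));
      z ^ 4 + lam * z ^ 10, z ^ 5 + lam * z ^ 13,
        (((n : K) - 3) * (z ^ 4 + lam * z ^ 10) * (z ^ 3 + lam * z ^ 7) ^ 2 - 2 * ((n : K) - 4) * (z ^ 5 + lam * z ^ 13) * (z ^ 3 + lam * z ^ 7) * (z ^ 2 + lam * z ^ 4) + ((n : K) - 5) * (z ^ 6 + lam * z ^ 16) * (z ^ 2 + lam * z ^ 4) ^ 2) / (2 * (n : K))]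
        / (((z ^ 2 + lam * z ^ 4) * (z ^ 4 + lam * z ^ 10) - (z ^ 3 + lam * z ^ 7) * (z ^ 3 + lam * z ^ 7)) * (z ^ 3 + lam * z ^ 7) ^ 2)
      = certF0 (2 * (n : K)) (n - 4) z lam := by
  rw [bordered_det_w lam z (n : K) (2 * (n : K)) _ _ rfl rfl, block4_minor]
  exact certF0_eq_value hz hz2 hn h6 h0 hv

/-- DERIVATION OF THE UNIFORM CERTIFICATE, chart free-1 (free column #1 = x^(0,2,1,d−3), v₁ = −E₀): the same quotient with v₁² equals `certF1 (2n) (n − 2) z λ`. -/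
theorem fermatColumn_free1 {z lam : K} {n : ℕ} (hz : z ≠ 0) (hz2 : z ^ 2 ≠ 1) (hn : z ^ n = -1) (h6 : 6 ≤ n) (h0 : lam ≠ 0)
    (hv : 1 + lam * z ^ 2 ≠ 0) :
    Matrix.det !![z ^ 2 + lam * z ^ 4, z ^ 3 + lam * z ^ 7,
        (((n : K) - 1) * (z ^ 2 + lam * z ^ 4) * (z ^ 3 + lam * z ^ 7) ^ 2 - 2 * ((n : K) - 2) * (z ^ 3 + lam * z ^ 7) * (z ^ 3 + lam * z ^ 7) * (z ^ 2 + lam * z ^ 4) + ((n : K) - 3) * (z ^ 4 + lam * z ^ 10) * (z ^ 2 + lam * z ^ 4) ^ 2) / (2 * (n : K));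
      z ^ 3 + lam * z ^ 7, z ^ 4 + lam * z ^ 10,
        (((n : K) - 2) * (z ^ 3 + lam * z ^ 7) * (z ^ 3 + lam * z ^ 7) ^ 2 - 2 * ((n : K) - 3) * (z ^ 4 + lam * z ^ 10) * (z ^ 3 + lam * z ^ 7) * (z ^ 2 + lam * z ^ 4) + ((n : K) - 4) * (z ^ 5 + lam * z ^ 13) * (z ^ 2 + lam * z ^ 4) ^ 2) / (2 * (n : K));
      z ^ 4 + lam * z ^ 10, z ^ 5 + lam * z ^ 13,
        (((n : K) - 3) * (z ^ 4 + lam * z ^ 10) * (z ^ 3 + lam * z ^ 7) ^ 2 - 2 * ((n : K) - 4) * (z ^ 5 + lam * z ^ 13) * (z ^ 3 + lam * z ^ 7) * (z ^ 2 + lam * z ^ 4) + ((n : K) - 5) * (z ^ 6 + lam * z ^ 16) * (z ^ 2 + lam * z ^ 4) ^ 2) / (2 * (n : K))]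
        / (((z ^ 2 + lam * z ^ 4) * (z ^ 4 + lam * z ^ 10) - (z ^ 3 + lam * z ^ 7) * (z ^ 3 + lam * z ^ 7)) * (-(z ^ 2 + lam * z ^ 4)) ^ 2)
      = certF1 (2 * (n : K)) (n - 2) z lam := by
  rw [bordered_det_w lam z (n : K) (2 * (n : K)) _ _ rfl rfl, block4_minor]
  exact certF1_eq_value hz hz2 hn h6 h0 hv

/-- ALL-DEGREE COVERING (the statement 'for every d ≥ 6 and every λ ∉ {0,1} one of the two charts is valid at λ with a non-zero certificate'): immediate from
gen 23's `cover` with c = 2n and p = n − 4 (so p + 2 = n − 2), for any z with z ≠ 0, z² ≠ 1. -/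
theorem cover_all (n : ℕ) (h6 : 6 ≤ n) {z : K} (hz0 : z ≠ 0) (hz2 : z ^ 2 ≠ 1) (lam : K) (h0 : lam ≠ 0) (h1 : lam ≠ 1) :
    (lam ≠ z ^ (n - 4) ∧ certF0 (2 * (n : K)) (n - 4) z lam ≠ 0) ∨ (lam ≠ z ^ (n - 2) ∧ certF1 (2 * (n : K)) (n - 2) z lam ≠ 0) := by
  have hnK : (n : K) ≠ 0 := by exact_mod_cast (show n ≠ 0 by omega)
  have h2n : (2 * (n : K)) ≠ 0 := mul_ne_zero two_ne_zero hnK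
  have h := SurfaceFermatColumns.cover h2n (n - 4) hz0 hz2 lam h0 h1
  have e : n - 4 + 2 = n - 2 := by omega
  rw [e] at h
  exact h

end field

end Summit.HodgeConjecture.HodgeConjecture.HodgeLocus.Census.SurfaceAllDegrees
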